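import Summits.Ventures.CertifiedManyBodySolver.Observables.PairLROOnePointCeilingTT
import HarnessLib

/-!
# Ventures/CertifiedManyBodySolver — Observables/RungLeavesPairLROTTPrime.lean

HONEST FRAMING: first certified bounds on pairing observables; not a superconductivity verdict; every number
certified (two lineages + referee) or labelled float. hubbard-obs cell (D-0042); hubbard-obs-p1 seat
(`prover-hubbard-obs-p1-g5-0`), continuing the lead's WANTED-LOW «t′-generic At-leaf family» (RungLeavesTTPrime,
p1 g4: pair-window and ODLRO/Bragg shapes) with the one shape it did not carry: the SUMMIT-FORMAT pair-LRO
ceiling of RungLeavesSummit (`M3ObsPairLROCeilingAt_tp0`) at an arbitrary next-nearest-neighbour hopping `t′`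
(the A0 anchor `t′ = −1/4`). Zero compute; no certificate; no `sorry`; no new NAMED leaf (the named leaf stays
`M3ObsPairLROCeiling_tp0`).

* `M3ObsPairLROCeilingAt tp c` — for every family `ψ_L` of unit `(rectN (7/8) L, S^z = 0)`-sector ground states
  of `hubbardTorusTT' L 1 tp 8`: `liminf_k |Λ_{2k}|⁻² Σ_{x,y∈Λ_{2k}} P_d(2k; x, y) ≤ c`;
  `M3ObsPairLROCeilingAt_zero_iff` — at `tp = 0` it IS `M3ObsPairLROCeilingAt_tp0 c` (definitional); `_mono`;
* dischargers (both `tp`-generic, CONDITIONAL ON THE CLAIM NODES fed in): `_of_orbitRow` — one certified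
  `D₄`-orbit LOWER cell on the negated pair box word (`PairLROTorusCeilingRow.m3_liminf_dWavePairFieldLRO_le_of_orbitLowerRow_neg`)
  ⇒ the ceiling at every `c ≥ −q/|B|²`; `_of_onePoint_variational_certificate` — one OP1-E one-point window
  certificate (`PairLROOnePointCeilingTT.dWavePairLRO_liminf_le_of_onePoint_variational_certificate_M3`) ⇒ the
  ceiling at every `c ≥ 2(c₀ − Σ‖a_k‖ + (Σ_σ μ_σ)(7/16 − ν))²`; `M3ObsPairLROCeiling_tp0_of_ceilingAt_zero`.
HONEST: a ceiling never speaks to presence; nothing here is certified.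
References: D. J. Scalapino, Phys. Rep. 250 (1995) 329, §2 eq. (2.4) [Scalapino1995]; T. Koma, H. Tasaki,
J. Stat. Phys. 76 (1994) 745, Theorem 2.2 [KomaTasaki1994].
-/

noncomputable section

namespace Summit.Ventures.CertifiedManyBodySolver.Observables

open Matrix Finset Literature.MathematicalPhysics.QuantumLattice Literature.Probability.LatticeModels
open Literature.MathematicalPhysics.QuantumLattice.HubbardWave0 ThermodynamicLimit
open Literature.MathematicalPhysics.QuantumManyBody.StateRelaxation
open Complex Filter Topology
open scoped BigOperators ComplexOrder

/-! ## The summit-format pair-LRO ceiling at hopping `t′` -/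

/-- **A certified ceiling `c` on the summit's `d`-wave pair-field LRO sequence at `(8, 7/8, t′)`**: for every
family `ψ_L` of unit `(rectN (7/8) L, S^z = 0)`-sector ground states of `hubbardTorusTT' L 1 tp 8`,
`liminf_k |Λ_{2k}|⁻² Σ_{x,y∈Λ_{2k}} P_d(2k; x, y) ≤ c` (the RungLeavesSummit `M3ObsPairLROCeilingAt_tp0` shape at
hopping `t′`). [cite: Scalapino1995, §2 eq. (2.4)] -/
def M3ObsPairLROCeilingAt (tp : ℝ) (c : ℚ) : Prop :=
  ∀ (ψ : ∀ L, Fock (Orb (FermionTorus 2 L))),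
    (∀ L, IsGroundStateInSector (hubbardTorusTT' L 1 tp 8) (rectN (7 / 8) L) 0 (ψ L)) →
    (∀ L, star (ψ L) ⬝ᵥ ψ L = 1) →
    liminf (fun k : ℕ => (∑ x ∈ halfOpenBox 2 (2 * k), ∑ y ∈ halfOpenBox 2 (2 * k),
        torusPullback (pairFieldCorr dWaveFormFactor ψ) (2 * k) x y) /
          ((#(halfOpenBox 2 (2 * k)) : ℝ)) ^ 2) atTop ≤ ((c : ℚ) : ℝ)

/-- At `t′ = 0` the generic ceiling IS `M3ObsPairLROCeilingAt_tp0 c` (definitional). -/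
theorem M3ObsPairLROCeilingAt_zero_iff (c : ℚ) : M3ObsPairLROCeilingAt 0 c ↔ M3ObsPairLROCeilingAt_tp0 c :=
  Iff.rfl

/-- … hence the NAMED `t′ = 0` leaf from the generic ceiling at `t′ = 0` with `c ≤ 1/2`. -/
theorem M3ObsPairLROCeiling_tp0_of_ceilingAt_zero {c : ℚ} (h : M3ObsPairLROCeilingAt 0 c) (hc : c ≤ 1 / 2) :
    M3ObsPairLROCeiling_tp0 :=
  M3ObsPairLROCeilingAt_tp0_mono ((M3ObsPairLROCeilingAt_zero_iff c).1 h) hc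

/-- Monotone transport. -/
theorem M3ObsPairLROCeilingAt_mono {tp : ℝ} {c c' : ℚ} (h : M3ObsPairLROCeilingAt tp c) (hcc : c ≤ c') :
    M3ObsPairLROCeilingAt tp c' :=
  fun ψ hψ hψ1 => (h ψ hψ hψ1).trans (by exact_mod_cast hcc)

/-- **One certified `D₄`-orbit cell on the negated pair box word ⇒ the ceiling (hopping `t′`)**: a LOWER orbit
cell `q ≤ ·` on `−pairBoxWord … B` (box `B ≠ ∅`, `1 ∈ S`) at cap `u ≥ hi`, `M3EnergyUpperRow tp hi`, gives
`M3ObsPairLROCeilingAt tp c` for every `c ≥ −q/|B|²`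
(`PairLROTorusCeilingRow.m3_liminf_dWavePairFieldLRO_le_of_orbitLowerRow_neg`). [cite: Scalapino1995, §2 eq. (2.4)] -/
theorem M3ObsPairLROCeilingAt_of_orbitRow {tp : ℝ} {u hi q c : ℚ} {S : Finset (DihedralGroup 4)}
    (h1 : (1 : DihedralGroup 4) ∈ S) {B : Finset (Site 2)} (hB : B.Nonempty)
    (h : M3CorrOrbitLowerRow tp u q S (B.biUnion (pairRegion (insert (0 : Site 2) unitSteps)))
      (-pairBoxWord (insert (0 : Site 2) unitSteps) dWaveFormFactor B))
    (hE : M3EnergyUpperRow tp hi) (hhi : hi ≤ u) (hc : -((q : ℚ) : ℝ) / ((B.card : ℝ)) ^ 2 ≤ ((c : ℚ) : ℝ)) :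
    M3ObsPairLROCeilingAt tp c :=
  fun ψ hψ hψ1 => (m3_liminf_dWavePairFieldLRO_le_of_orbitLowerRow_neg h1 hB h hE hhi ψ hψ hψ1).trans hc

/-- **One OP1-E one-point window certificate ⇒ the ceiling (hopping `t′`)** at every
`c ≥ 2(c₀ − Σ‖a_k‖ + (Σ_σ μ_σ)(7/16 − ν))²`: the source-free Koma–Tasaki / KHvdL route
(`PairLROOnePointCeilingTT.dWavePairLRO_liminf_le_of_onePoint_variational_certificate_M3`), with the point group
of the certificate fixing the `d`-wave form factor (`b1gSign = 1`), ONE cap row (`κ ≥ 0`, cap node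
`M3EnergyUpperRow tp hi`, `hi ≤ u`), filling rows, SOS, symmetry defects, anti-Hermitian parts and residual
words, and NO stationarity / charged-word terms. [cite: KomaTasaki1994, Theorem 2.2] -/
theorem M3ObsPairLROCeilingAt_of_onePoint_variational_certificate {tp : ℝ} {hi c : ℚ}
    (hE : M3EnergyUpperRow tp hi) {κ u : ℝ} (hκ : 0 ≤ κ) (hhi : ((hi : ℚ) : ℝ) ≤ u)
    {Λ Λ' : Finset (Site 2)} (hΛ : Λ ⊆ Λ')
    (h0 : thicken ({0} : Finset (Site 2)) 1 ⊆ Λ') (hz : (0 : Site 2) ∈ Λ')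
    (hP : pairRegion (insert (0 : Site 2) unitSteps) 0 ⊆ Λ')
    {S : Finset (DihedralGroup 4)} (h1 : (1 : DihedralGroup 4) ∈ S) (hmul : ∀ a ∈ S, ∀ b ∈ S, a * b ∈ S)
    (hS1 : ∀ γ ∈ S, b1gSign γ = 1)
    (μ : Fin 2 → ℝ) (ν : ℝ)
    {m : Type*} [Fintype m] [DecidableEq m] {Λm : Matrix m m ℂ} (hΛm : Λm.PosSemidef)
    (O : m → FermionOp Λ')
    {ι : Type*} (tt : Finset ι) (γ : ι → DihedralGroup 4) (hγS : ∀ l ∈ tt, γ l ∈ S) (wv : ι → Site 2)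
    (hsh : ∀ l, d4ShiftSet (γ l) (wv l) Λ ⊆ Λ') (Y : ι → FermionOp Λ)
    {δ : Type*} (ah : Finset δ) (dc : δ → ℝ) (V : δ → FermionOp Λ')
    {κ'' : Type*} (w : Finset κ'') (a : κ'' → ℂ) (word : κ'' → List (Orb (PolySite Λ') × Bool)) {c₀ : ℝ}
    (hcert : -(fermionEmbed (PolySite.incl hP) (localPairAt (insert (0 : Site 2) unitSteps) dWaveFormFactor 0)) -
        (c₀ : ℂ) • (1 : FermionOp Λ') -
        ∑ σ : Fin 2, ((μ σ : ℝ) : ℂ) • (nAt 0 hz σ - ((ν : ℝ) : ℂ) • (1 : FermionOp Λ')) -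
        ((κ : ℝ) : ℂ) • (((u : ℝ) : ℂ) • (1 : FermionOp Λ') -
          fermionEmbed (PolySite.incl h0) ((hubbardTTPrimeFermionInteraction 1 tp 8).meanEnergyObs 1)) =
      gramForm Λm O +
        ∑ l ∈ tt, (fermionEmbed (PolySite.incl (hsh l)) (fermionEmbed (PolySite.d4Emb (γ l) (wv l) Λ) (Y l)) -
            fermionEmbed (PolySite.incl hΛ) (Y l)) +
        (∑ m' ∈ ah, ((dc m' : ℝ) : ℂ) • ((V m')ᴴ - V m') + ∑ k ∈ w, a k • ladderWord (word k)))
    (hc : 2 * (c₀ - ∑ k ∈ w, ‖a k‖ + (∑ σ : Fin 2, μ σ) * ((7 / 8 : ℝ) / 2 - ν)) ^ 2 ≤ ((c : ℚ) : ℝ)) :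
    M3ObsPairLROCeilingAt tp c :=
  fun ψ hψ hψ1 => dWavePairLRO_liminf_le_of_onePoint_variational_certificate_M3 hE hκ hhi hΛ h0 hz hP h1 hmul
    hS1 μ ν hΛm O tt γ hγS wv hsh Y ah dc V w a word hcert hc ψ hψ hψ1

end Summit.Ventures.CertifiedManyBodySolver.Observables

end
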